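import Summits.CriticalPhenomena.PercolationContinuityZ3.Theorems.PercNearOneGluingNoHeavyPcintKingRouteSkeleton
import Literature.Probability.Percolation.SiteMonotonicity
import Literature.Probability.Percolation.SitePercolationMeasure
import Literature.Probability.Percolation.SitePaths
import HarnessLib

/-!
# PCINT lane, king route, K1 step (6a): the square-lattice side of the box inequality as a `P_q`-probability

Cell `prim-pcint`, seat `prim-pcint-1` (gen 9); memo `run/shared/lean/prim/pcint/KING-ROUTE.md` §K1 (6).

Bridge between the tree's site percolation measure and the finite sums of `AdaptDom`: for a finite `Λ ⊆ ℤ²`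
containing the origin,

  `P_q(0 ⟷ ∂ⁱⁿΛ in Λ) ≤ Σ_{ω : Λ → Bool} π_q(ω) · reachIndicator (boxGraph Λ) 0 B ω`,

where `B` is the set of sites of `Λ` on its inner boundary (`KingRoute.real_exitEvent_le_sum_wt_reach`).  Ingredients:
the finite-sum formula `sitePercolation_real_eq_sum` for the event `exitEvent (zdGraph 2) Λ 0` (determined by `Λ`,
`determinedBy_exitEvent`), the identification of the tree's weights `siteWeight` on `Λ → Prop` with `AdaptDom.wt` on
`Λ → Bool` (`siteWeight_propCfg`), and the fact that a configuration in the trace of the exit event has an open path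
in `boxGraph Λ` from the origin to `B` (`reachIndicator_eq_one_of_mem_traceEvent`).  Combined with
`KingRoute.sum_wt_reach_le_sum_mu_starPath` this bounds `P_q(0 ⟷ ∂ⁱⁿΛ)` by the `μ`-weight of `∗`-paths, once
step (3) supplies the domination hypothesis.
-/

noncomputable section

namespace Summit.CriticalPhenomena.PercolationContinuityZ3.Theorems.Pcint

namespace KingRoute

open Finset AdaptDom ClusterExpl VdBEProcess Literature.Probability.Percolation Literature.Probability.LatticeModels

variable (Λ : Finset (Site 2))

/-- The `Prop`-valued configuration of a `Bool`-valued one. -/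
def propCfg (ω : ↥Λ → Bool) : ↥Λ → Prop := fun v => ω v = true

/-- `propCfg` is the inverse of `Equiv.propEquivBool` applied pointwise; as an equivalence. -/
def propCfgEquiv : (↥Λ → Bool) ≃ (↥Λ → Prop) where
  toFun := propCfg Λ
  invFun y := fun v => @decide (y v) (Classical.dec _)
  left_inv ω := by funext v; simp [propCfg]
  right_inv y := by funext v; simp [propCfg]

variable {Λ}

/-- **The tree's product weight is `AdaptDom.wt`**: `siteWeight q (propCfg ω) = wt q ω`. -/
theorem siteWeight_propCfg (q : unitInterval) (ω : ↥Λ → Bool) : siteWeight q (propCfg Λ ω) = wt (q : ℝ) ω := by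
  unfold siteWeight wt
  refine Finset.prod_congr rfl fun v _ => ?_
  unfold propCfg bern
  cases ω v <;> simp

/-- The `ℤ²`-configuration lifted from `y = propCfg ω`: the sites `v ∈ Λ` with `ω v = true`. -/
theorem mem_liftSiteConfig_propCfg {ω : ↥Λ → Bool} {v : Site 2} :
    liftSiteConfig Λ (propCfg Λ ω) v ↔ ∃ h : v ∈ Λ, ω ⟨v, h⟩ = true := Iff.rfl

/-- **A configuration in the trace of the exit event reaches the inner boundary inside `boxGraph Λ`**: if the lift of
`propCfg ω` lies in `exitEvent (zdGraph 2) Λ 0` then `reachIndicator (boxGraph Λ) 0 B ω = 1` for `B` = the sites of `Λ`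
on its inner boundary. -/
theorem reachIndicator_eq_one_of_mem_traceEvent (h0 : (0 : Site 2) ∈ Λ) {ω : ↥Λ → Bool}
    (hω : propCfg Λ ω ∈ traceEvent Λ (exitEvent (zdGraph 2) Λ 0)) :
    reachIndicator (boxGraph Λ) ⟨0, h0⟩ (Λ.attach.filter fun v => v.1 ∈ innerBoundary (zdGraph 2) Λ) ω = 1 := by
  classical
  set C : Set (Site 2) := {v | liftSiteConfig Λ (propCfg Λ ω) v} with hC
  have hE : C ∈ exitEvent (zdGraph 2) Λ 0 := hω
  obtain ⟨b, hb, hconn⟩ := mem_exitEvent_iff.1 hE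
  have hpath : PathIn (zdGraph 2) (↑Λ ∩ C) 0 b := PathIn.of_mem_siteConnIn hconn
  -- lift the lattice path to a chain in `boxGraph Λ` of sites open in `ω`
  have key : ∀ {t : Site 2}, Relation.ReflTransGen (fun a c => (zdGraph 2).Adj a c ∧ c ∈ (↑Λ ∩ C : Set (Site 2))) 0 t →
      ∃ ht : t ∈ Λ, Relation.ReflTransGen (fun a c : ↥Λ => (boxGraph Λ).Adj a c ∧ ω c = true) ⟨0, h0⟩ ⟨t, ht⟩ := by
    intro t h
    induction h with
    | refl => exact ⟨h0, Relation.ReflTransGen.refl⟩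
    | @tail u t _ hut ih =>
      obtain ⟨hu, hchain⟩ := ih
      obtain ⟨ht', hωt⟩ := (mem_liftSiteConfig_propCfg (ω := ω)).1 hut.2.2
      exact ⟨ht', hchain.tail ⟨(boxGraph_adj Λ).2 hut.1, hωt⟩⟩
  have hbΛ : b ∈ Λ := (mem_innerBoundary_iff.1 hb).1
  have h0C : (0 : Site 2) ∈ (↑Λ ∩ C : Set (Site 2)) := hpath.left_mem
  obtain ⟨h0', hω0⟩ := (mem_liftSiteConfig_propCfg (ω := ω)).1 h0C.2
  obtain ⟨hbΛ', hchain⟩ := key hpath.2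
  have hopen : OpenPath (boxGraph Λ) ⟨0, h0⟩ ω ⟨b, hbΛ⟩ := ⟨hω0, hchain⟩
  have hB : (⟨b, hbΛ⟩ : ↥Λ) ∈ Λ.attach.filter fun v => v.1 ∈ innerBoundary (zdGraph 2) Λ :=
    mem_filter.2 ⟨mem_attach _ _, hb⟩
  unfold reachIndicator
  rw [if_pos ⟨_, hB, hopen⟩]

/-- **The square-lattice side of the box inequality**: `P_q(0 ⟷ ∂ⁱⁿΛ in Λ) ≤ E_{π_q}[reachIndicator]` (in fact an
equality; the inequality is what the king route uses). -/
theorem real_exitEvent_le_sum_wt_reach (h0 : (0 : Site 2) ∈ Λ) (q : unitInterval) :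
    (sitePercolation (Site 2) q).real (exitEvent (zdGraph 2) Λ 0) ≤
      ∑ ω : ↥Λ → Bool, wt (q : ℝ) ω *
        reachIndicator (boxGraph Λ) ⟨0, h0⟩ (Λ.attach.filter fun v => v.1 ∈ innerBoundary (zdGraph 2) Λ) ω := by
  classical
  rw [sitePercolation_real_eq_sum q (determinedBy_exitEvent (G := zdGraph 2) Λ 0)]
  set E := exitEvent (zdGraph 2) Λ 0 with hE
  set B := Λ.attach.filter fun v => v.1 ∈ innerBoundary (zdGraph 2) Λ with hB
  have hwt : ∀ ω : ↥Λ → Bool, 0 ≤ wt (q : ℝ) ω := fun ω => wt_nonneg q.2.1 q.2.2 ω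
  have hreach : ∀ ω : ↥Λ → Bool, 0 ≤ reachIndicator (boxGraph Λ) ⟨0, h0⟩ B ω := by
    intro ω; unfold reachIndicator; split_ifs <;> norm_num
  -- transport the trace sum to `Λ → Bool` along `propCfgEquiv`
  calc _ = ∑ ω ∈ (univ.filter fun y : ↥Λ → Prop => y ∈ traceEvent Λ E).map (propCfgEquiv Λ).symm.toEmbedding,
        siteWeight q (propCfg Λ ω) := by
        rw [Finset.sum_map]
        refine Finset.sum_congr (by ext y; simp) fun y _ => ?_
        have : propCfg Λ ((propCfgEquiv Λ).symm y) = y := (propCfgEquiv Λ).apply_symm_apply y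
        rw [Equiv.coe_toEmbedding, this]
    _ = ∑ ω ∈ (univ.filter fun y : ↥Λ → Prop => y ∈ traceEvent Λ E).map (propCfgEquiv Λ).symm.toEmbedding,
        wt (q : ℝ) ω * reachIndicator (boxGraph Λ) ⟨0, h0⟩ B ω := by
        refine Finset.sum_congr rfl fun ω hω => ?_
        rw [Finset.mem_map] at hω
        obtain ⟨y, hy, rfl⟩ := hω
        have hy' : y ∈ traceEvent Λ E := (mem_filter.1 hy).2
        have hpc : propCfg Λ ((propCfgEquiv Λ).symm.toEmbedding y) = y := (propCfgEquiv Λ).apply_symm_apply y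
        rw [siteWeight_propCfg, reachIndicator_eq_one_of_mem_traceEvent h0 (by rw [hpc]; exact hy'), mul_one]
    _ ≤ ∑ ω, wt (q : ℝ) ω * reachIndicator (boxGraph Λ) ⟨0, h0⟩ B ω :=
        Finset.sum_le_sum_of_subset_of_nonneg (Finset.subset_univ _) fun ω _ _ => mul_nonneg (hwt ω) (hreach ω)

end KingRoute

end Summit.CriticalPhenomena.PercolationContinuityZ3.Theorems.Pcint

end
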